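import Summits.KontsevichZagierPeriods.KontsevichZagierPeriods.Theorems.RootDecompRationalCubeDichotomyNashMultiGenP05

/-!
# P4 `MonomialDivisionAt` — exact division by a rational coordinate hyperplane preserves étale
# presentations (lineage `decomp-kz-lens-2`, generation 10, kernel fragment of the presented-germ calculus)

If `g` carries `MultiGenData n k g x₀` (landed `…NashMultiGenP01`), `x₀ i = c ∈ ℚ`, and `g = (xᵢ − c)·q`
near `x₀` with `q` analytic at `x₀`, then `q` carries `MultiGenData n (k + k) q x₀`: the generators of `q`
are the generators `u` of `g` AND THEIR RESTRICTIONS `u₀(x) = u(x|_{xᵢ := c})` to the hyperplane.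
Algebra: `F − F[xᵢ:=c] = (Xᵢ − c)Ψ`, divided differences `F[xᵢ:=c](y) − F[xᵢ:=c](y') = M(y,y')(y − y')`
with `M(y,y) = ∂_yF[xᵢ:=c]` (proved by differentiating the identity), Cramer
`det M·(u − u₀) = −(xᵢ − c)·adj(M)Ψ`, and `A[xᵢ:=c](x,u₀ x) = 0` because `g` vanishes on the hyperplane;
hence `q = (det M·A¹ − Θ·adj(M)Ψ)/(B·det M)` off the hyperplane and, by continuity, near `x₀`.
The Nash solution / semialgebraicity / shrinking are supplied by the landed `multiGenData_of_pointData`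
and `solutions_eq_near` (P05).  This is the statement `MonomialDivisionAt n` of
`EtaleCubeBypass.lean` §3 (token-identical body), proved for every `n`.  No `sorry`.
-/

/-! # `RootDecompRationalCubeDichotomyMonomialDivisionP0` — part 1/2 of the mechanical ≤260-line split of `RootDecompRationalCubeDichotomyMonomialDivisionP1.lean`
(split by the decomp-kz census seat for landing; mathematics unchanged). -/

noncomputable section

set_option linter.dupNamespace false
set_option linter.unusedVariables false
set_option linter.unusedSectionVars false

namespace Summit.KontsevichZagierPeriods.RootDecompRationalCubeDichotomy.Rung24903.MonomialDivision

open MvPolynomial Filter Topology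
open Summit.KontsevichZagierPeriods.RootDecompRationalCubeDichotomy.Rung29430.MultiGen
  (MultiGenData multiGenData_of_pointData ratBox isOpen_ratBox isSemialgebraic_ratBox exists_ratBox_subset)
open Summit.KontsevichZagierPeriods.RootDecompRationalCubeDichotomy.Rung29430.MultiGen.NashImplicit
  (solutions_eq_near)

/-! ### §A  Generic polynomial algebra -/

section Generic

variable {σ τ : Type*}

/-- `p − p[X_v := c]` is divisible by `X_v − c`. -/
theorem exists_sub_subst_eq_mul [DecidableEq σ] (v : σ) (c : ℚ) (p : MvPolynomial σ ℚ) :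
    ∃ q : MvPolynomial σ ℚ,
      p - MvPolynomial.aeval (fun r => if r = v then C c else (X r : MvPolynomial σ ℚ)) p =
        (X v - C c) * q := by
  induction p using MvPolynomial.induction_on with
  | C a =>
    refine ⟨0, ?_⟩
    rw [MvPolynomial.aeval_C, MvPolynomial.algebraMap_eq, sub_self, mul_zero]
  | add p q hp hq =>
    obtain ⟨a, ha⟩ := hp
    obtain ⟨b, hb⟩ := hq
    exact ⟨a + b, by rw [map_add]; linear_combination ha + hb⟩
  | mul_X p r hp =>
    obtain ⟨a, ha⟩ := hp
    by_cases hr : r = v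
    · subst hr
      refine ⟨a * C c + p, ?_⟩
      rw [map_mul, MvPolynomial.aeval_X, if_pos rfl]
      linear_combination (C c) * ha
    · refine ⟨a * X r, ?_⟩
      rw [map_mul, MvPolynomial.aeval_X, if_neg hr]
      linear_combination (X r) * ha

/-- Divided differences: if two renamings `e₁, e₂` agree except on variables sent to `y j` resp.
`y' j`, then `rename e₁ p − rename e₂ p = Σ_j Φ_j · (X (y j) − X (y' j))`. -/
theorem exists_divDiff {ι : Type*} [Fintype ι] (e₁ e₂ : σ → τ) (y y' : ι → τ)
    (hagree : ∀ r, e₁ r = e₂ r ∨ ∃ j, e₁ r = y j ∧ e₂ r = y' j) (p : MvPolynomial σ ℚ) :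
    ∃ Φ : ι → MvPolynomial τ ℚ,
      rename e₁ p - rename e₂ p = ∑ j, Φ j * (X (y j) - X (y' j)) := by
  suffices h : rename e₁ p - rename e₂ p ∈
      Ideal.span (Set.range fun j => (X (y j) - X (y' j) : MvPolynomial τ ℚ)) by
    obtain ⟨c, hc⟩ := Ideal.mem_span_range_iff_exists_fun.1 h
    exact ⟨c, hc.symm⟩
  induction p using MvPolynomial.induction_on with
  | C a => rw [rename_C, rename_C, sub_self]; exact Ideal.zero_mem _
  | add p q hp hq =>
    rw [map_add, map_add, add_sub_add_comm]
    exact Ideal.add_mem _ hp hq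
  | mul_X p r hp =>
    rw [map_mul, map_mul, rename_X, rename_X]
    have : rename e₁ p * X (e₁ r) - rename e₂ p * X (e₂ r) =
        (rename e₁ p - rename e₂ p) * X (e₁ r) + rename e₂ p * (X (e₁ r) - X (e₂ r)) := by ring
    rw [this]
    refine Ideal.add_mem _ (Ideal.mul_mem_right _ _ hp) (Ideal.mul_mem_left _ _ ?_)
    rcases hagree r with h | ⟨j, h1, h2⟩
    · rw [h, sub_self]; exact Ideal.zero_mem _
    · rw [h1, h2]; exact Ideal.subset_span ⟨j, rfl⟩

/-- `pderiv` through an injective-at-`s` renaming. -/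
theorem pderiv_rename_of_iff (e : σ → τ) (s : σ) (t : τ) (hst : ∀ r, e r = t ↔ r = s)
    (p : MvPolynomial σ ℚ) : pderiv t (rename e p) = rename e (pderiv s p) := by
  classical
  induction p using MvPolynomial.induction_on with
  | C a => simp
  | add p q hp hq => rw [map_add, map_add, map_add, map_add, hp, hq]
  | mul_X p r hp =>
    rw [map_mul, rename_X, pderiv_mul, hp, pderiv_mul, map_add, map_mul, map_mul, rename_X]
    congr 2
    by_cases hr : r = s
    · subst hr
      rw [(hst r).2 rfl, pderiv_X_self, pderiv_X_self, map_one]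
    · have hne : e r ≠ t := fun h => hr ((hst r).1 h)
      rw [pderiv_X_of_ne hne, pderiv_X_of_ne hr, map_zero]

/-- `pderiv` in a variable outside the range of the renaming vanishes. -/
theorem pderiv_rename_of_ne (e : σ → τ) (t : τ) (hne : ∀ r, e r ≠ t) (p : MvPolynomial σ ℚ) :
    pderiv t (rename e p) = 0 := by
  classical
  induction p using MvPolynomial.induction_on with
  | C a => simp
  | add p q hp hq => rw [map_add, map_add, hp, hq, add_zero]
  | mul_X p r hp => rw [map_mul, rename_X, pderiv_mul, hp, pderiv_X_of_ne (hne r), zero_mul, mul_zero, add_zero]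

/-- `pderiv` commutes with a substitution that fixes the variable `s` and substitutes `∂_s`-constants
elsewhere. -/
theorem pderiv_aeval_of_fix [DecidableEq σ] (g : σ → MvPolynomial σ ℚ) (s : σ) (hs : g s = X s)
    (hg : ∀ r, r ≠ s → pderiv s (g r) = 0) (p : MvPolynomial σ ℚ) :
    pderiv s (MvPolynomial.aeval g p) = MvPolynomial.aeval g (pderiv s p) := by
  induction p using MvPolynomial.induction_on with
  | C a => rw [MvPolynomial.aeval_C, MvPolynomial.algebraMap_eq, pderiv_C, map_zero]
  | add p q hp hq => rw [map_add, map_add, map_add, map_add, hp, hq]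
  | mul_X p r hp =>
    rw [map_mul, MvPolynomial.aeval_X, pderiv_mul, hp, pderiv_mul, map_add, map_mul, map_mul,
      MvPolynomial.aeval_X]
    congr 2
    by_cases hr : r = s
    · subst hr; rw [hs, pderiv_X_self, map_one]
    · rw [hg r hr, pderiv_X_of_ne hr, map_zero]

end Generic

/-! ### §B  The concrete variable bookkeeping: `σ = Fin (n+k)` (variables `x, y`),
`τ = Fin (n + (k+k))` (variables `x, y, y'`) -/

section Concrete

variable {n k : ℕ}

/-- first copy: `x ↦ x`, `y ↦ y`. -/
def e₁ (n k : ℕ) : Fin (n + k) → Fin (n + (k + k)) :=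
  Fin.append (fun i : Fin n => Fin.castAdd (k + k) i) (fun j : Fin k => Fin.natAdd n (Fin.castAdd k j))

/-- second copy: `x ↦ x`, `y ↦ y'`. -/
def e₂ (n k : ℕ) : Fin (n + k) → Fin (n + (k + k)) :=
  Fin.append (fun i : Fin n => Fin.castAdd (k + k) i) (fun j : Fin k => Fin.natAdd n (Fin.natAdd k j))

/-- the variable `y_j` of `τ`. -/
def Y (n k : ℕ) (j : Fin k) : Fin (n + (k + k)) := Fin.natAdd n (Fin.castAdd k j)

/-- the variable `y'_j` of `τ`. -/
def Y' (n k : ℕ) (j : Fin k) : Fin (n + (k + k)) := Fin.natAdd n (Fin.natAdd k j)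

/-- the diagonal substitution `y' := y` back to `σ`. -/
def dmap (n k : ℕ) : Fin (n + (k + k)) → MvPolynomial (Fin (n + k)) ℚ :=
  Fin.append (fun i : Fin n => X (Fin.castAdd k i))
    (Fin.append (fun j : Fin k => X (Fin.natAdd n j)) (fun j : Fin k => X (Fin.natAdd n j)))

/-- Auxiliary step `e₁_left`. [bookkeeping] -/
@[simp] theorem e₁_left (i : Fin n) : e₁ n k (Fin.castAdd k i) = Fin.castAdd (k + k) i := by
  simp [e₁]
/-- Auxiliary step `e₁_right`. [bookkeeping] -/
@[simp] theorem e₁_right (j : Fin k) : e₁ n k (Fin.natAdd n j) = Y n k j := by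
  simp [e₁, Y]
/-- Auxiliary step `e₂_left`. [bookkeeping] -/
@[simp] theorem e₂_left (i : Fin n) : e₂ n k (Fin.castAdd k i) = Fin.castAdd (k + k) i := by
  simp [e₂]
/-- Auxiliary step `e₂_right`. [bookkeeping] -/
@[simp] theorem e₂_right (j : Fin k) : e₂ n k (Fin.natAdd n j) = Y' n k j := by
  simp [e₂, Y']
/-- Auxiliary step `dmap_left`. [bookkeeping] -/
@[simp] theorem dmap_left (i : Fin n) : dmap n k (Fin.castAdd (k + k) i) = X (Fin.castAdd k i) := by
  simp [dmap]
/-- Auxiliary step `dmap_Y`. [bookkeeping] -/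
@[simp] theorem dmap_Y (j : Fin k) : dmap n k (Y n k j) = X (Fin.natAdd n j) := by
  simp only [dmap, Y, Fin.append_right, Fin.append_left]
/-- Auxiliary step `dmap_Y'`. [bookkeeping] -/
@[simp] theorem dmap_Y' (j : Fin k) : dmap n k (Y' n k j) = X (Fin.natAdd n j) := by
  simp only [dmap, Y', Fin.append_right]

/-- Auxiliary step `e₁_eq_Y_iff`. [bookkeeping] -/
theorem e₁_eq_Y_iff (r : Fin (n + k)) (j : Fin k) : e₁ n k r = Y n k j ↔ r = Fin.natAdd n j := by
  induction r using Fin.addCases with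
  | left i =>
    rw [e₁_left]
    simp only [Fin.ext_iff, Fin.val_castAdd, Fin.val_natAdd, Y]
  | right j' =>
    rw [e₁_right]
    simp only [Fin.ext_iff, Fin.val_castAdd, Fin.val_natAdd, Y]

/-- Auxiliary step `e₂_eq_Y'_iff`. [bookkeeping] -/
theorem e₂_eq_Y'_iff (r : Fin (n + k)) (j : Fin k) : e₂ n k r = Y' n k j ↔ r = Fin.natAdd n j := by
  induction r using Fin.addCases with
  | left i =>
    rw [e₂_left]
    simp only [Fin.ext_iff, Fin.val_castAdd, Fin.val_natAdd, Y']
    all_goals omega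
  | right j' =>
    rw [e₂_right]
    simp only [Fin.ext_iff, Fin.val_natAdd, Y']
    all_goals omega

/-- Auxiliary step `e₁_ne_Y'`. [bookkeeping] -/
theorem e₁_ne_Y' (r : Fin (n + k)) (j : Fin k) : e₁ n k r ≠ Y' n k j := by
  induction r using Fin.addCases with
  | left i =>
    rw [e₁_left]; simp only [ne_eq, Fin.ext_iff, Fin.val_castAdd, Fin.val_natAdd, Y']; all_goals omega
  | right j' =>
    rw [e₁_right]; simp only [ne_eq, Fin.ext_iff, Fin.val_castAdd, Fin.val_natAdd, Y, Y']; all_goals omega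

/-- Auxiliary step `e₂_ne_Y`. [bookkeeping] -/
theorem e₂_ne_Y (r : Fin (n + k)) (j : Fin k) : e₂ n k r ≠ Y n k j := by
  induction r using Fin.addCases with
  | left i =>
    rw [e₂_left]; simp only [ne_eq, Fin.ext_iff, Fin.val_castAdd, Fin.val_natAdd, Y]; all_goals omega
  | right j' =>
    rw [e₂_right]; simp only [ne_eq, Fin.ext_iff, Fin.val_castAdd, Fin.val_natAdd, Y, Y']; all_goals omega

/-- Auxiliary step `Y_ne_Y'`. [bookkeeping] -/
theorem Y_ne_Y' (j l : Fin k) : Y n k j ≠ Y' n k l := by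
  simp only [ne_eq, Fin.ext_iff, Fin.val_castAdd, Fin.val_natAdd, Y, Y']; all_goals omega

/-- Auxiliary step `Y_injective`. [bookkeeping] -/
theorem Y_injective : Function.Injective (Y n k) := by
  intro j l h
  simp only [Fin.ext_iff, Fin.val_castAdd, Fin.val_natAdd, Y] at h
  exact Fin.ext (by omega)

/-- Auxiliary step `e₁_agree_e₂`. [bookkeeping] -/
theorem e₁_agree_e₂ (r : Fin (n + k)) :
    e₁ n k r = e₂ n k r ∨ ∃ j, e₁ n k r = Y n k j ∧ e₂ n k r = Y' n k j := by
  induction r using Fin.addCases with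
  | left i => left; rw [e₁_left, e₂_left]
  | right j => right; exact ⟨j, e₁_right j, e₂_right j⟩

/-- `δ ∘ rename e₁ = id`. -/
theorem aeval_dmap_rename_e₁ (p : MvPolynomial (Fin (n + k)) ℚ) :
    MvPolynomial.aeval (dmap n k) (rename (e₁ n k) p) = p := by
  rw [MvPolynomial.aeval_rename]
  have : (dmap n k) ∘ (e₁ n k) = X := by
    funext r
    induction r using Fin.addCases with
    | left i => simp
    | right j => simp
  rw [this, MvPolynomial.aeval_X_left_apply]

end Concrete
end Summit.KontsevichZagierPeriods.RootDecompRationalCubeDichotomy.Rung24903.MonomialDivision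
end
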